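import Literature.NumberTheory.GaloisCohomology.Howard2004.DVRSettingEngineStub
import Literature.NumberTheory.GaloisCohomology.Howard2004.DVRSettingEngineKappa
import Literature.NumberTheory.GaloisCohomology.Howard2004.InertFrobeniusRingClassProofs
import Literature.NumberTheory.GaloisCohomology.Howard2004.TowerMorphismPushforward
import Literature.NumberTheory.GaloisCohomology.Howard2004.FiniteSingularTameAdmissible
import Literature.NumberTheory.GaloisCohomology.Howard2004.DegreeTwoInertProofs
import HarnessLib

/-!
# Howard 2004, Lemma 1.6.4 on a `DVRSetting`: the ENGINE hypothesis `hKS` («the Kolyvagin system relations»,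
# `loc_ℓ κ_n = 0 ↔ loc_ℓ κ_{nℓ} = 0`) DISCHARGED on the classes read on `H¹(K, T^{(k)})` (theorems only)

B. Howard, *The Heegner point Kolyvagin system*, Compositio Math. **140** (2004) (arXiv:1202.6340), proof of
Lemma 1.6.4 (arXiv Lemma 2.6.4, p. 12 L8–9 and L23–25): «By Proposition (induction), `loc_ℓ(κ^{(k)}(nℓ)) = 0`, but
then the Kolyvagin system relations imply that `loc_ℓ(κ_n^{(k)}) = 0`» (Case i) and «the Kolyvagin system relations
guarantee that `loc_ℓ(κ^{(k)}_{nℓ}) ≠ 0`» (Case ii) — with Def. 1.2.3 (the (ks) relations, `φ^{fs}_ℓ` an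
isomorphism on the finite classes, Def. 1.1.8) and Prop. 1.1.9 (`H¹_f(K_λ) ∩ H¹_tr(K_λ) = 0`).

The ENGINE `StubLemmaInductionProofs.mem_stub_of_stubLemmaInduction` (cell `pub/bsd-print-x9`, brick of x10b-p1-w2)
takes this as the binder
`hKS : ∀ k n ℓ, ↑n ⊆ P k → ℓ ∈ P k → ℓ ∉ n → (loc k n ℓ (κ k n) = 0 ↔ loc k (insert ℓ n) ℓ (κ k (insert ℓ n)) = 0)`;
in the data layer of the instantiation (`DVRSettingEngineData`, `DVRSettingEngineKappa`, `DVRSettingEngineStub`)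
`P k = enginePrimes k = 𝓛 ∩ 𝓛_{2e_k-1}(T)`, `κ k n = kappaR κ pins k n ∈ H¹_{F(n)}(K, T^{(k)})` (the Kolyvagin class
de-tensored by the pins' generators and read on `T^{(k)}`), `loc k n ℓ = loc_λ` on `H¹(K, T^{(k)})` (`locR`).  This
file (brick ENGINE-hKS, seat `bsd-line-x10b-p1-w8`) discharges it from the landed generic bricks:

* §1 (generic `LevelData` glue) `redH1_cohomologyMap` (`red_{n → nλ} ∘ H¹(π_n) = H¹(π_{nλ})`),
  `localization_mem_transverseCondition_of_mem_selmerAt` (an `F(n)`-Selmer class of `T/I_nT` is transverse at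
  `λ ∈ n`), and **`localization_eq_zero_of_mem_selmerAt_of_mem_unramifiedSubgroup`** — the hypothesis `hdisj` of
  KS-LOC (`KolyvaginRelationLocalizationProofs`) DISCHARGED for level data over an imaginary quadratic `K` at
  `λ ∈ n ∈ 𝓝(𝓛)` with trivial local action: Prop. 1.1.9's disjointness at the inert `λ` (x9-p1-w3's
  `disjoint_unramifiedSubgroup_transverseCondition_of_isImaginaryQuadratic`);
* §2 **`DVRSetting.localization_kappaR_eq_zero_iff`** — `loc_λ (kappaR k n) = 0 ↔ loc_λ (kappaR k (insert λ n)) = 0`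
  in `H¹(K_λ, T^{(k)})`, for `λ ∉ n`, `insert λ n ∈ 𝓝(𝓛)` and `ker π_{nλ} = 0`: KS-LOC's
  `localization_redH1_eq_zero_iff_of_isKolyvaginSystem` (on the de-tensored classes in `H¹(K, T^{(k)}/I_{nλ})`) read
  on `H¹(K, T^{(k)})` through `map_subtype_κ_eq_kappaR_tmul` and PRES `localization_cohomologyMap_eq_zero_iff`, its
  side hypotheses discharged by `SatisfiesH.fs_admissible` (Def. 1.1.8), KS-LOC §4 (annihilators), H.0 (trivial
  local action, `trivial_toLocal_of_mem_primes`) and §1;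
* §3 **`DVRSetting.locR_kappaR_eq_zero_iff`** — THE ENGINE BINDER `hKS` at `P k = enginePrimes k` in the data
  currency `locR` / `kappaR` (`ker π = 0` and `𝓝(𝓛)`-membership from `DVRSettingEngineStub`).

THEOREMS ONLY: no definition, no named fact, no instance, no notation, no `sorry`.  Generic in the `DVRSetting` (so it
holds on the refined settings `S.refine hy pins`).  Lemma 1.6.4, Thm. 1.6.1 and `thm161_dvrKolyvaginBound` are NOT
proved here; no summit statement is proved; BSD is not proved by any of this.
-/

set_option autoImplicit false

noncomputable section

open Function NumberField IsDedekindDomain Field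
open scoped NumberField ContRepresentation Classical TensorProduct

namespace Literature.NumberTheory.GaloisCohomology.Howard2004

open Literature.NumberTheory.GaloisRepresentations
open Literature.NumberTheory.GaloisRepresentations.DiscreteGaloisModule

/-! ## §1 Generic glue on level data -/

namespace LevelData

variable {K : Type} [Field K] [NumberField K] {M : Type} [AddCommGroup M] [TopologicalSpace M]
  [DiscreteTopology M] {R : Type} [CommRing R] [Module R M]
  {p : ℕ} [Fact p.Prime] {ρ : DiscreteGaloisModule K M} {t : SelmerTriple p ρ}
  {N : Finset (HeightOneSpectrum (𝓞 K)) → Type} [∀ n, AddCommGroup (N n)]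
  [∀ n, TopologicalSpace (N n)] [∀ n, DiscreteTopology (N n)] [∀ n, Module R (N n)]

omit [Fact p.Prime] in
/-- **`red_{n → nλ} ∘ H¹(π_n) = H¹(π_{nλ})` on `H¹(K, T)`**: the reduction `T/I_nT → T/I_{nλ}T` composed with the
presentation of `T/I_nT` is the presentation of `T/I_{nλ}T` (`transition ∘ π_n = π_{nλ}`), hence so on `H¹`.
[cite: Howard2004HeegnerKolyvagin, Def. 1.1.3 and Def. 1.2.3 (arXiv p. 5 L93–99, p. 6 L126–140)] -/
theorem redH1_cohomologyMap (D : LevelData R ρ t N) (n : Finset (HeightOneSpectrum (𝓞 K)))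
    (v : HeightOneSpectrum (𝓞 K)) (x : galoisCohomology ρ 1) :
    D.redH1 n v ((D.isQuotientBy n).cohomologyMap 1 x) = (D.isQuotientBy (insert v n)).cohomologyMap 1 x :=
  cohomologyMap_one_comp_eq ρ (D.ρq n) (D.ρq (insert v n)) (D.π n).toAddMonoidHom (D.isQuotientBy n).equivariant
    ((D.isQuotientBy n).transition (D.isQuotientBy (insert v n))
      (levelIdeal_mono ρ (Finset.subset_insert v n))).toAddMonoidHom
    ((D.isQuotientBy n).transition_equivariant (D.isQuotientBy (insert v n))
      (levelIdeal_mono ρ (Finset.subset_insert v n)))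
    (D.π (insert v n)).toAddMonoidHom (D.isQuotientBy (insert v n)).equivariant
    (fun m => (D.isQuotientBy n).transition_apply (D.isQuotientBy (insert v n))
      (levelIdeal_mono ρ (Finset.subset_insert v n)) m) x

/-- **An `F(n)`-Selmer class of `T/I_nT` is transverse at every `λ ∈ n`**: its localisation at `λ` lies in
`H¹_tr(K_λ, T/I_nT)` — the condition of `F(n)` at `λ ∈ n` is the transverse one (Def. 1.2.2), propagated along
`H¹(K_λ, π_n)`, and `H¹(K_λ, π_n)` carries `H¹_tr(K_λ, T)` into `H¹_tr(K_λ, T/I_nT)`.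
[cite: Howard2004HeegnerKolyvagin, Def. 1.1.3, Def. 1.2.2, Def. 1.2.3 (arXiv p. 5 L98–99, p. 6 L110–125, p. 7 L1–6)] -/
theorem localization_mem_transverseCondition_of_mem_selmerAt (D : LevelData R ρ t N)
    (jbar : AlgebraicClosure K →+* ℂ) {n : Finset (HeightOneSpectrum (𝓞 K))} {v : HeightOneSpectrum (𝓞 K)}
    (hv : v ∈ n) {y : galoisCohomology (D.ρq n) 1} (hy : y ∈ D.selmerAt jbar n) :
    galoisCohomology.localization (D.ρq n) (Sum.inr v) 1 y ∈
      transverseCondition p (D.ρq n) (residueChar v) jbar v := by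
  have h1 := (SelmerStructure.mem_selmerGroup_iff _ _).mp hy (Sum.inr v)
  rw [IsQuotientBy.propagateStructure_apply, SelmerTriple.atLevel_cond_inr_of_mem t jbar hv] at h1
  obtain ⟨c, hc, hcy⟩ := AddSubgroup.mem_map.mp h1
  rw [← hcy]
  exact cohomologyMap_mem_transverseCondition ρ (D.ρq n) (D.π n).toAddMonoidHom (D.isQuotientBy n).equivariant
    (residueChar v) jbar v hc

/-- The residue characteristic of a finite place is a prime number. [folklore] -/
private theorem residueChar_prime' (v : HeightOneSpectrum (𝓞 K)) : (residueChar v).Prime := by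
  haveI : Finite (𝓞 K ⧸ v.asIdeal) := v.asIdeal.finiteQuotientOfFreeOfNeBot v.ne_bot
  letI : Field (𝓞 K ⧸ v.asIdeal) := Ideal.Quotient.field _
  unfold residueChar
  exact CharP.char_is_prime (𝓞 K ⧸ v.asIdeal) _

/-- **Prop. 1.1.9 for the level modules — the hypothesis `hdisj` of KS-LOC discharged**: over an imaginary quadratic
`K`, at `λ ∈ n ∈ 𝓝(𝓛)` (so `λ` is a degree-two prime, i.e. `λ = ℓ𝓞_K` is inert) and for a level module `T/I_nT` on
which `Γ_{K_λ}` acts trivially, an `F(n)`-Selmer class whose localisation at `λ` is unramified has ZERO localisation at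
`λ`: it is transverse at `λ` (`localization_mem_transverseCondition_of_mem_selmerAt`) and
`H¹_f(K_λ, T/I_nT) ∩ H¹_tr(K_λ, T/I_nT) = 0` (`disjoint_unramifiedSubgroup_transverseCondition_of_isImaginaryQuadratic`).
[cite: Howard2004HeegnerKolyvagin, Prop. 1.1.9 and Lemma 1.6.4 proof, Case ii (arXiv p. 6 L17–25; p. 12 L23–25)] -/
theorem localization_eq_zero_of_mem_selmerAt_of_mem_unramifiedSubgroup (D : LevelData R ρ t N)
    (jbar : AlgebraicClosure K →+* ℂ) (hK : EllipticCurves.IsImaginaryQuadratic K)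
    {n : Finset (HeightOneSpectrum (𝓞 K))} {v : HeightOneSpectrum (𝓞 K)} (hn : n ∈ t.levelSet) (hv : v ∈ n)
    (htriv : ∀ (g : absoluteGaloisGroup (v.adicCompletion K)) (x : N n), GaloisRep.toLocal v (D.ρq n) g x = x)
    {y : galoisCohomology (D.ρq n) 1} (hy : y ∈ D.selmerAt jbar n)
    (hur : galoisCohomology.localization (D.ρq n) (Sum.inr v) 1 y ∈
      unramifiedSubgroup (GaloisRep.toLocal v (D.ρq n)) 1) :
    galoisCohomology.localization (D.ρq n) (Sum.inr v) 1 y = 0 := by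
  have hvP : v ∈ t.primes := hn (Finset.mem_coe.mpr hv)
  have h2 : IsDegreeTwo v := (t.primes_subset hvP).1
  have hdis := disjoint_unramifiedSubgroup_transverseCondition_of_isImaginaryQuadratic p hK (D.ρq n) jbar
    (residueChar_prime' v) (isPrime_span_residueChar_of_isDegreeTwo hK.1 h2) (natCast_residueChar_mem_asIdeal v) htriv
  exact (AddSubgroup.disjoint_def.mp hdis) hur (D.localization_mem_transverseCondition_of_mem_selmerAt jbar hv hy)

end LevelData

/-! ## §2 «`loc_λ κ_n = 0 ⟺ loc_λ κ_{nλ} = 0`» on `H¹(K, T^{(k)})` -/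

namespace DVRSetting

variable {p : ℕ} [Fact p.Prime] {K : Type} [Field K] [NumberField K]
  {R : Type} [CommRing R] [IsDomain R] [IsDiscreteValuationRing R] [Algebra ℤ_[p] R]
  {N : ℕ → Type} [∀ k, AddCommGroup (N k)] [∀ k, TopologicalSpace (N k)]
  [∀ k, DiscreteTopology (N k)] [∀ k, Module R (N k)]
  {Rk : ℕ → Type} [∀ k, CommRing (Rk k)] [∀ k, IsLocalRing (Rk k)] [∀ k, TopologicalSpace (Rk k)]
  [∀ k, DiscreteTopology (Rk k)] [∀ k, Algebra ℤ_[p] (Rk k)] [∀ k, Algebra R (Rk k)]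
  [∀ k, Module (Rk k) (N k)] [∀ k, IsScalarTower R (Rk k) (N k)]
  {Nbar : Type} [AddCommGroup Nbar] [TopologicalSpace Nbar] [DiscreteTopology Nbar]
  [∀ k, Module (Rk k) Nbar]
  {Nq : ℕ → Finset (HeightOneSpectrum (𝓞 K)) → Type} [∀ k n, AddCommGroup (Nq k n)]
  [∀ k n, TopologicalSpace (Nq k n)] [∀ k n, DiscreteTopology (Nq k n)]
  [∀ k n, Module (Rk k) (Nq k n)] [∀ k n, Module R (Nq k n)]
  [∀ k n, IsScalarTower R (Rk k) (Nq k n)]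

/-- The de-tensored class of `κ^{(k)}_n` in `H¹_{F(n)}(K, T^{(k)}/I_n)` IS `H¹(π_n)(kappaR k n)`:
`κ^{(k)}_n = ⟨H¹(π_n)(kappaR k n), _⟩ ⊗ γ_n` (the defining identity `map_subtype_κ_eq_kappaR_tmul`, pulled back along
the injective `subtype ⊗ 1`). [cite: Howard2004HeegnerKolyvagin, Def. 1.2.3 and Lemma 1.6.4 (arXiv p. 7 L1–12, p. 11 L88–90)] -/
theorem κ_eq_cohomologyMap_kappaR_tmul (S : DVRSetting p K R N Rk Nbar Nq)
    (κ : S.KolyvaginSystem) (pins : ∀ v : HeightOneSpectrum (𝓞 K), TamePin v) (k : ℕ)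
    {n : Finset (HeightOneSpectrum (𝓞 K))} (hn : n ∈ (S.t k).levelSet) (hker : LinearMap.ker ((S.LD k).π n) = ⊥) :
    κ.κ k n =
      (⟨((S.LD k).isQuotientBy n).cohomologyMap 1 (S.kappaR κ pins k n),
          ((S.LD k).cohomologyMap_mem_selmerAt_iff S.jbar n hker _).mpr (S.kappaR_mem_selmerGroup κ pins k hker hn)⟩ :
        ↥((S.LD k).selmerAt S.jbar n)) ⊗ₜ[ℤ]
        (PiTensorProduct.tprod ℤ fun q : ↥n => (pins q).gbar : Gn (K := K) n) := by
  have hγ : ∀ w ∈ n, ∀ x : Gell w, x ∈ AddSubgroup.zmultiples ((fun w => (pins w).gbar) w) :=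
    fun w _ x => (pins w).mem_zmultiples_gbar x
  have hA : ∀ w ∈ n, ∀ a : galoisCohomology ((S.LD k).ρq n) 1, Nat.card (Gell w) • a = 0 :=
    fun _ hw a => (S.LD k).natCard_gell_smul_galoisCohomology_eq_zero hn hw a
  have hAs : ∀ w ∈ n, ∀ s : ↥((S.LD k).selmerAt S.jbar n), Nat.card (Gell w) • s = 0 :=
    fun _ hw s => (S.LD k).natCard_gell_smul_selmerAt_eq_zero S.jbar hn hw s
  obtain ⟨s, hs⟩ := (tmulRight_tprod_bijective (fun w => (pins w).gbar) n hγ hAs).2 (κ.κ k n)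
  have h1 := S.map_subtype_κ_eq_kappaR_tmul κ pins k hker hn
  rw [← hs] at h1
  change TensorProduct.map _ _ (s ⊗ₜ[ℤ] _) = _ at h1
  rw [TensorProduct.map_tmul, LinearMap.id_apply, AddMonoidHom.coe_toIntLinearMap, AddSubgroup.coe_subtype] at h1
  have h2 : (s : galoisCohomology ((S.LD k).ρq n) 1) =
      ((S.LD k).isQuotientBy n).cohomologyMap 1 (S.kappaR κ pins k n) :=
    (tmulRight_tprod_bijective (fun w => (pins w).gbar) n hγ hA).1 h1
  rw [← hs]
  change s ⊗ₜ[ℤ] _ = _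
  congr 1
  exact Subtype.ext h2

/-- **«`loc_λ κ_n = 0 ⟺ loc_λ κ_{nλ} = 0`» READ ON `H¹(K, T^{(k)})`** for the classes `kappaR` (the engine's
`κ k n`): at `λ ∉ n` with `nλ ∈ 𝓝(𝓛)` and `I_{nλ} T^{(k)} = 0` (`ker π_{nλ} = 0`), the localisation at `λ` of
`kappaR k n` vanishes iff that of `kappaR k (insert λ n)` does.  KS-LOC's iff on the de-tensored classes in
`H¹(K, T^{(k)}/I_{nλ})` (the (ks) relation at `(n, λ)`, `φ^{fs}_λ` injective on the finite classes by H's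
`fs_admissible`, and Prop. 1.1.9 at the inert `λ` with the H.0-trivial local action — §1), transported along the
bijections `H¹(π_{nλ})`, `H¹(K_λ, π_{nλ})` (PRES) and `red ∘ H¹(π_n) = H¹(π_{nλ})`.
[cite: Howard2004HeegnerKolyvagin, Lemma 1.6.4 proof (arXiv p. 12 L8–9, L23–25), Def. 1.2.3, Def. 1.1.8, Prop. 1.1.9] -/
theorem localization_kappaR_eq_zero_iff (S : DVRSetting p K R N Rk Nbar Nq) (hy : S.SatisfiesH)
    (κ : S.KolyvaginSystem) (pins : ∀ v : HeightOneSpectrum (𝓞 K), TamePin v) (k : ℕ)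
    {n : Finset (HeightOneSpectrum (𝓞 K))} {v : HeightOneSpectrum (𝓞 K)} (hv : v ∉ n)
    (hnv : insert v n ∈ (S.t k).levelSet) (hkerv : LinearMap.ker ((S.LD k).π (insert v n)) = ⊥) :
    galoisCohomology.localization (S.T.ρ k) (Sum.inr v) 1 (S.kappaR κ pins k n) = 0 ↔
      galoisCohomology.localization (S.T.ρ k) (Sum.inr v) 1 (S.kappaR κ pins k (insert v n)) = 0 := by
  have hn : n ∈ (S.t k).levelSet := fun w hw =>
    hnv (Finset.mem_coe.mpr (Finset.mem_insert_of_mem (Finset.mem_coe.mp hw)))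
  have hker : LinearMap.ker ((S.LD k).π n) = ⊥ := by
    rw [((S.LD k).isQuotientBy n).ker_eq, eq_bot_iff]
    have h := ((S.LD k).isQuotientBy (insert v n)).ker_eq
    rw [hkerv] at h
    calc levelIdeal (R := Rk k) (S.T.ρ k) n • (⊤ : Submodule (Rk k) (N k))
        ≤ levelIdeal (R := Rk k) (S.T.ρ k) (insert v n) • (⊤ : Submodule (Rk k) (N k)) :=
          Submodule.smul_mono_left (levelIdeal_mono (S.T.ρ k) (Finset.subset_insert v n))
      _ = ⊥ := h.symm
      _ ≤ ⊥ := le_rfl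
  have hvP : v ∈ (S.t k).primes := LevelData.mem_primes_of_insert_mem_levelSet hnv
  have htriv : ∀ (g : absoluteGaloisGroup (v.adicCompletion K)) (x : Nq k (insert v n)),
      GaloisRep.toLocal v ((S.LD k).ρq (insert v n)) g x = x :=
    fun g x => trivial_toLocal_of_mem_primes (S.LD k) hvP
      (fun σ hσ y => (S.LD k).ρq_apply_eq_self_of_h0 (hy.h0 k) (Finset.mem_insert_self v n) hσ y) g x
  have hiff := (S.LD k).localization_redH1_eq_zero_iff_of_isKolyvaginSystem S.jbar (κ.ks k).1
    (fun w => (pins w).gbar) hv hnv ((hy.fs_admissible k).fsBijectiveAt hnv (Finset.mem_insert_self v n))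
    (fun w _ x => (pins w).mem_zmultiples_gbar x) (fun x => (pins v).mem_zmultiples_gbar x)
    (fun w hw y => (S.LD k).natCard_gell_smul_singularQuotient_eq_zero hnv (Finset.mem_insert_of_mem hw) v y)
    (fun y => (S.LD k).natCard_gell_smul_singularQuotient_eq_zero hnv (Finset.mem_insert_self v n) v y)
    (fun y hur => (S.LD k).localization_eq_zero_of_mem_selmerAt_of_mem_unramifiedSubgroup S.jbar hy.imagQuad
      hnv (Finset.mem_insert_self v n) htriv y.2 hur)
    (S.κ_eq_cohomologyMap_kappaR_tmul κ pins k hn hker)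
    (S.κ_eq_cohomologyMap_kappaR_tmul κ pins k hnv hkerv)
  dsimp only at hiff
  rw [(S.LD k).redH1_cohomologyMap, (S.LD k).localization_cohomologyMap_eq_zero_iff (insert v n) hkerv,
    (S.LD k).localization_cohomologyMap_eq_zero_iff (insert v n) hkerv] at hiff
  exact hiff

/-! ## §3 The ENGINE binder `hKS` at `P k = 𝓛 ∩ 𝓛_{2e_k-1}(T)` -/

/-- **The engine's hypothesis `hKS` DISCHARGED** (data currency of `DVRSettingEngineData` / `…Kappa` / `…Stub`):
for `↑n ⊆ P k`, `ℓ ∈ P k`, `ℓ ∉ n` (`P k = enginePrimes k = 𝓛 ∩ 𝓛_{2e_k-1}(T)`, so `nℓ ∈ 𝓝(𝓛)` and `I_{nℓ}` kills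
`T^{(k)}`), `loc_ℓ (kappaR k n) = 0 ↔ loc_ℓ (kappaR k (insert ℓ n)) = 0` for the `R`-linear localisation `locR`.
[cite: Howard2004HeegnerKolyvagin, Lemma 1.6.4 proof (arXiv p. 12 L8–9, L23–25) with Def. 1.2.3 and Prop. 1.1.9] -/
theorem locR_kappaR_eq_zero_iff (S : DVRSetting p K R N Rk Nbar Nq) (hy : S.SatisfiesH)
    (κ : S.KolyvaginSystem) (pins : ∀ v : HeightOneSpectrum (𝓞 K), TamePin v) (k : ℕ)
    {n : Finset (HeightOneSpectrum (𝓞 K))} {ℓ : HeightOneSpectrum (𝓞 K)} (hn : ↑n ⊆ S.enginePrimes k)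
    (hℓ : ℓ ∈ S.enginePrimes k) (hℓn : ℓ ∉ n) :
    S.locR k (Sum.inr ℓ) (S.kappaR κ pins k n) = 0 ↔ S.locR k (Sum.inr ℓ) (S.kappaR κ pins k (insert ℓ n)) = 0 := by
  have hnℓ : (↑(insert ℓ n) : Set (HeightOneSpectrum (𝓞 K))) ⊆ S.enginePrimes k := by
    rw [Finset.coe_insert]
    exact Set.insert_subset hℓ hn
  rw [locR_apply, locR_apply]
  exact S.localization_kappaR_eq_zero_iff hy κ pins k hℓn (S.mem_levelSet_of_subset_enginePrimes hy k k hnℓ)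
    (S.ker_π_eq_bot_of_subset_enginePrimes hy k hnℓ)

/-- The same in the `galoisCohomology.localization` spelling. [cite: Howard2004HeegnerKolyvagin, Lemma 1.6.4 proof (arXiv p. 12 L8–9, L23–25)] -/
theorem localization_kappaR_eq_zero_iff_of_subset_enginePrimes (S : DVRSetting p K R N Rk Nbar Nq)
    (hy : S.SatisfiesH) (κ : S.KolyvaginSystem) (pins : ∀ v : HeightOneSpectrum (𝓞 K), TamePin v) (k : ℕ)
    {n : Finset (HeightOneSpectrum (𝓞 K))} {ℓ : HeightOneSpectrum (𝓞 K)} (hn : ↑n ⊆ S.enginePrimes k)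
    (hℓ : ℓ ∈ S.enginePrimes k) (hℓn : ℓ ∉ n) :
    galoisCohomology.localization (S.T.ρ k) (Sum.inr ℓ) 1 (S.kappaR κ pins k n) = 0 ↔
      galoisCohomology.localization (S.T.ρ k) (Sum.inr ℓ) 1 (S.kappaR κ pins k (insert ℓ n)) = 0 := by
  have hnℓ : (↑(insert ℓ n) : Set (HeightOneSpectrum (𝓞 K))) ⊆ S.enginePrimes k := by
    rw [Finset.coe_insert]
    exact Set.insert_subset hℓ hn
  exact S.localization_kappaR_eq_zero_iff hy κ pins k hℓn (S.mem_levelSet_of_subset_enginePrimes hy k k hnℓ)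
    (S.ker_π_eq_bot_of_subset_enginePrimes hy k hnℓ)

end DVRSetting

end Literature.NumberTheory.GaloisCohomology.Howard2004

end
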